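import Mathlib

/-!
# Crux triage r2 k=2 (stmt-AtomisticToContinuum-10967) — abstract model of the
# `kinetic-clock-density-transport` factorisation `C⁺ ⟸ DiluteCornerLD ∧ LDDensityContinuity`

`Λ s σ` stands for `limsup_N (N+1)⁻¹ log I_N(s;σ)` (window of `s` kinetic units at reduced density `σ`).
Findings (all kernel-checked below):
* `uniform_of_corner_of_flat`  — the card's glue: corner decay + the TYPED (ii) ⇒ uniform decay (C⁺);
* `flat_of_uniform`            — the tightness direction: C⁺ ⇒ typed (ii) (functional ≥ 0);
* `flat_iff_uniform_of_corner` — hence GIVEN the corner stub (i), the typed (ii) is EQUIVALENT to C⁺;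
* `lipCont_does_not_transport` — a genuine modulus of continuity in the density (even Lipschitz,
  uniform in the window) does NOT transport corner decay to fixed density: `Λ s σ := σ`.
So the typed (ii) is not "continuity in the density" but asymptotic density-FLATNESS, i.e. C⁺ modulo (i).
-/

namespace TriageR2K2

/-- (i) `DiluteCornerLD`, abstract: density threshold chosen AFTER the window. -/
def Corner (Λ : ℝ → ℝ → ℝ) : Prop :=
  ∀ δ : ℝ, 0 < δ → ∃ s₀ : ℝ, 0 < s₀ ∧ ∀ s : ℝ, s₀ ≤ s →
    ∃ σ₂ : ℝ, 0 < σ₂ ∧ ∀ σ : ℝ, 0 < σ → σ < σ₂ → Λ s σ ≤ δ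

/-- (ii) `LDDensityContinuity` AS TYPED in the card: no `|σ − σ'|` dependence at all. -/
def Flat (Λ : ℝ → ℝ → ℝ) (σ₁ : ℝ) : Prop :=
  ∀ δ : ℝ, 0 < δ → ∃ s₀ : ℝ, 0 < s₀ ∧ ∀ s : ℝ, s₀ ≤ s →
    ∀ σ σ' : ℝ, 0 < σ → σ < σ₁ → 0 < σ' → σ' < σ₁ → Λ s σ ≤ Λ s σ' + δ

/-- A genuine (Lipschitz) modulus of continuity in the density, uniform in the window `s`. -/
def LipCont (Λ : ℝ → ℝ → ℝ) (σ₁ L : ℝ) : Prop :=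
  ∀ s σ σ' : ℝ, 0 < σ → σ < σ₁ → 0 < σ' → σ' < σ₁ → Λ s σ ≤ Λ s σ' + L * |σ - σ'|

/-- `C⁺ = DensityUniformKineticDecay`, abstract: one window for every density below `σ₀`. -/
def Uniform (Λ : ℝ → ℝ → ℝ) (σ₀ : ℝ) : Prop :=
  ∀ δ : ℝ, 0 < δ → ∃ s₀ : ℝ, 0 < s₀ ∧ ∀ s : ℝ, s₀ ≤ s → ∀ σ : ℝ, 0 < σ → σ < σ₀ → Λ s σ ≤ δ

/-- The card's glue, abstractly: corner + typed (ii) ⇒ C⁺. -/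
theorem uniform_of_corner_of_flat {Λ : ℝ → ℝ → ℝ} {σ₁ : ℝ} (hσ₁ : 0 < σ₁)
    (h₁ : Corner Λ) (h₂ : Flat Λ σ₁) : Uniform Λ σ₁ := by
  intro δ hδ
  obtain ⟨s₁, hs₁, H₁⟩ := h₁ (δ / 2) (by positivity)
  obtain ⟨s₂, _, H₂⟩ := h₂ (δ / 2) (by positivity)
  refine ⟨max s₁ s₂, lt_max_of_lt_left hs₁, fun s hs σ hσ hσ' => ?_⟩
  obtain ⟨σ₂, hσ₂, H₁'⟩ := H₁ s ((le_max_left _ _).trans hs)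
  have hmin : 0 < min σ₂ σ₁ := lt_min hσ₂ hσ₁
  obtain ⟨σ', hσ'pos, hσ'lt₂, hσ'lt₁⟩ : ∃ σ' : ℝ, 0 < σ' ∧ σ' < σ₂ ∧ σ' < σ₁ :=
    ⟨min σ₂ σ₁ / 2, by positivity,
      by have := min_le_left σ₂ σ₁; linarith,
      by have := min_le_right σ₂ σ₁; linarith⟩
  have hA := H₂ s ((le_max_right _ _).trans hs) σ σ' hσ hσ' hσ'pos hσ'lt₁
  have hB := H₁' σ' hσ'pos hσ'lt₂
  linarith

/-- Tightness direction: C⁺ ⇒ typed (ii), for a nonnegative functional (`1 ≤ I_N`, p89719). -/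
theorem flat_of_uniform {Λ : ℝ → ℝ → ℝ} {σ₀ : ℝ} (hnn : ∀ s σ, 0 < σ → 0 ≤ Λ s σ)
    (h : Uniform Λ σ₀) : Flat Λ σ₀ := by
  intro δ hδ
  obtain ⟨s₀, hs₀, H⟩ := h δ hδ
  refine ⟨s₀, hs₀, fun s hs σ σ' hσ hσ₁ hσ' _ => ?_⟩
  have h1 := H s hs σ hσ hσ₁
  have h2 := hnn s σ' hσ'
  linarith

/-- GIVEN the corner stub (i), the typed (ii) is equivalent to C⁺ (crux-uniform-in-density). -/
theorem flat_iff_uniform_of_corner {Λ : ℝ → ℝ → ℝ} {σ₁ : ℝ} (hσ₁ : 0 < σ₁)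
    (hnn : ∀ s σ, 0 < σ → 0 ≤ Λ s σ) (h₁ : Corner Λ) : Flat Λ σ₁ ↔ Uniform Λ σ₁ :=
  ⟨uniform_of_corner_of_flat hσ₁ h₁, flat_of_uniform hnn⟩

/-- Counter-model: `Λ s σ := σ` decays in the corner and is 1-Lipschitz in the density uniformly in
the window, yet is not uniformly small on `(0,1)`: continuity does NOT transport corner decay. -/
theorem lipCont_does_not_transport :
    ∃ Λ : ℝ → ℝ → ℝ, (∀ s σ, 0 < σ → 0 ≤ Λ s σ) ∧ Corner Λ ∧ LipCont Λ 1 1 ∧ ¬ Uniform Λ 1 := by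
  refine ⟨fun _ σ => σ, fun _ σ hσ => hσ.le, ?_, ?_, ?_⟩
  · intro δ hδ
    exact ⟨1, one_pos, fun s _ => ⟨δ, hδ, fun σ _ hσ => hσ.le⟩⟩
  · intro s σ σ' _ _ _ _
    show σ ≤ σ' + 1 * |σ - σ'|
    have := le_abs_self (σ - σ')
    linarith
  · intro h
    obtain ⟨s₀, _, H⟩ := h (1 / 2) (by norm_num)
    have := H s₀ le_rfl (3 / 4) (by norm_num) (by norm_num)
    norm_num at this

/-- The same counter-model also satisfies the typed (ii)?  NO — flatness fails for it (so the typed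
(ii) is strictly stronger than any distance-dependent modulus): -/
theorem counterModel_not_flat : ¬ Flat (fun _ σ => σ) 1 := by
  intro h
  obtain ⟨s₀, _, H⟩ := h (1 / 4) (by norm_num)
  have := H s₀ le_rfl (3 / 4) (1 / 4) (by norm_num) (by norm_num) (by norm_num) (by norm_num)
  norm_num at this

end TriageR2K2
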